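import Literature.NumberTheory.Automorphic.ArchRankinSelbergGammaBookkeepingGL2
import HarnessLib

/-!
# The Gamma bookkeeping of the archimedean `GL₂ × GL₂` Rankin–Selberg integral, refined hypotheses
# (Humphries–Jo (2024), Thm. 5.6, Prop. 5.8; Jacquet (1972), §17–§19)

Topic `NumberTheory/Automorphic`; namespace `Literature.NumberTheory.Automorphic`. Theorems only (no
definition, no named fact, no instance). Variant of `ArchRankinSelbergGammaBookkeepingGL2` /
`ArchRankinSelbergGammaLocalGL2` with the unitarity hypotheses on the parameters of the tags in EXACTLY the
form the unitarity files deliver them for the Hecke test vectors (`ArchHeckeTestVectorConstructionGL2`):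

* real tags: `discPlus k` — `k ≥ 1`; `weightOneSym κ` — `re κ = 0` (`re_weightOneParam_eq_zero` on the inner
  weight-one vector); `weightZero` — `|im ν| < ½` (`abs_im_besselParam_lt_half`, the vector being `K_∞`-finite);
  `weightZeroX` — only `|im ν| ≤ ½` (`abs_im_besselParam_le_half` on the inner weight-zero vector, whose
  `K_∞`-finiteness the shape type does not record; the exponent `μ/2 + 1` has one unit of slack);
* complex tags: blanket `|im ν^a|, |im ν^h| ≤ m/2 + 1` (`sq_im_besselParamC_le` on the inner highest vector `y`,
  `besselParamC_sq_eq_conj_sq`), and strictly `<` only for `holPow b` (`τ^h(E₀₁) y ≠ 0`, resp. `y = e`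
  `K_∞`-finite for `b = 0`) and `antiPowLowest 0` (the lowest vector is a `K_∞`-translate of `y`), the strings
  carrying `im ν^a = m/2` (`im_besselParamC_eq_half_of_string`); `antiPowLowest b`, `b ≥ 1`, has slack.

Results: `rsGammaProduct_local_realTagRec₂`, `rsGammaProduct_local_complexTagRec₂` (recursor form) and the
global `rsGammaProduct_archRankinSelberg_tagged₂` — `T(s) · M(s) = A c^s ∏ Γ_ℝ(s + a_j) ∏ Γ_ℂ(s + b_j)` on
`re s > 1`, `A ≠ 0`, `c > 0`, `re a_j, re b_j > -1`.

## References

* P. Humphries, Y. Jo, *Test vectors for archimedean period integrals*, Publ. Mat. 68 (2024), Thm. 5.6,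
  Prop. 5.8 [HumphriesJo2024].
* H. Jacquet, *Automorphic Forms on GL(2), Part II*, LNM 278 (1972), §17–§19 [Jacquet1972GL2II].
-/

noncomputable section

open MeasureTheory Measure NumberField NumberField.InfinitePlace NumberField.mixedEmbedding IsDedekindDomain Set Filter
open scoped MatrixGroups ENNReal NNReal Classical ComplexConjugate

namespace Literature.NumberTheory.Automorphic

open Literature.Analysis.FunctionSpaces

/-! ### 1. The local identities with refined hypotheses -/

section Local

/-- **The local Gamma identity at a REAL place, refined hypotheses, recursor form.** As
`rsGammaProduct_local_realTag` (`ArchRankinSelbergGammaLocalGL2`) with the bound for the modified weight-zero tag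
`weightZeroX` weakened to `|im ν| ≤ ½` (its exponent `μ/2 + 1` has real part `1`, one more than needed) — the form
in which the assembly obtains it from `abs_im_besselParam_le_half` on the inner weight-zero vector — and the exponent
`β(t)` written as a `RealTag.rec` term. [cite: Jacquet1972GL2II, §17–§19] [cite: HumphriesJo2024, Thm. 5.6 and Prop. 5.8] -/
theorem rsGammaProduct_local_realTagRec₂ (μ ν : ℂ) (t : RealTag) (μ' ν' : ℂ) (t' : RealTag) (hμ : μ.re = 0) (hμ' : μ'.re = 0)
    (ht : match t with
      | .discPlus k => 1 ≤ k
      | .weightOneSym κ => κ.re = 0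
      | .weightZero => |ν.im| < 1 / 2
      | .weightZeroX => |ν.im| ≤ 1 / 2)
    (ht' : match t' with
      | .discPlus k => 1 ≤ k
      | .weightOneSym κ => κ.re = 0
      | .weightZero => |ν'.im| < 1 / 2
      | .weightZeroX => |ν'.im| ≤ 1 / 2) :
    (∀ s : ℂ, 1 < s.re → Integrable (fun x : ℝ =>
      realShapeOf μ ν t x * conj (realShapeOf μ' ν' t' x) * ((|x| : ℝ) : ℂ) ^ (s - 2))) ∧
    ∃ (A : ℂ) (c : ℝ) (d₁ d₂ : ℕ) (a : Fin d₁ → ℂ) (b : Fin d₂ → ℂ), A ≠ 0 ∧ 0 < c ∧ (∀ j, -1 < (a j).re) ∧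
      (∀ j, -1 < (b j).re) ∧ ∀ s : ℂ, 1 < s.re →
        Complex.Gammaℝ (2 * s + 2 * (RealTag.rec (motive := fun _ => ℂ) (fun k => (μ + k) / 2) (fun _ => (μ + 1) / 2) (μ / 2) (μ / 2 + 1) t +
            conj (RealTag.rec (motive := fun _ => ℂ) (fun k => (μ' + k) / 2) (fun _ => (μ' + 1) / 2) (μ' / 2) (μ' / 2 + 1) t'))) *
          ∫ x : ℝ, realShapeOf μ ν t x * conj (realShapeOf μ' ν' t' x) * ((|x| : ℝ) : ℂ) ^ (s - 2) =
          A * (c : ℂ) ^ s * ((∏ j, Complex.Gammaℝ (s + a j)) * ∏ j, Complex.Gammaℂ (s + b j)) := by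
  have h2π : (0 : ℝ) < 2 * Real.pi := by positivity
  have hν0 : 0 ≤ |ν.im| := abs_nonneg _
  have hν'0 : 0 ≤ |ν'.im| := abs_nonneg _
  -- the conjugated profiles on `(0, ∞)`
  have cexp : ∀ (β' : ℂ) (u : ℝ), 0 < u → conj (expShape β' (2 * Real.pi) u) = expShape (conj β') (2 * Real.pi) u :=
    fun β' u hu => conj_expShape hu.le β' _
  have cbes : ∀ (β' ν'' : ℂ) (u : ℝ), 0 < u → conj (besselShape β' (2 * Real.pi) ν'' u) = besselShape (conj β') (2 * Real.pi) (conj ν'') u :=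
    fun β' ν'' u hu => conj_besselShape h2π hu β' ν''
  cases t with
  | discPlus k =>
    have hk : (1 : ℝ) ≤ k := by exact_mod_cast ht
    cases t' with
    | discPlus k' =>
      have hk' : (1 : ℝ) ≤ k' := by exact_mod_cast ht'
      refine rsGammaProduct_local_realShapeFn (by simp) (fun u hu => by rw [cexp _ u hu]) (rsGammaProduct_local_exp_exp ?_)
      simp only [Complex.add_re, Complex.conj_re, Complex.div_ofNat_re, Complex.natCast_re, hμ, hμ']
      linarith
    | weightOneSym κ' =>
      refine rsGammaProduct_local_realShapeFn (by simp) (fun u hu => by rw [cbes _ _ u hu]) (rsGammaProduct_local_exp_bessel ?_)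
      have hκ' : κ'.re = 0 := ht'
      have hνe' : |(conj (Complex.I * (κ' - 1 / 2))).im| = 1 / 2 := by
        simp only [Complex.conj_im, abs_neg, Complex.mul_im, Complex.I_re, Complex.I_im, Complex.sub_re, Complex.one_re, hκ',
          zero_mul, one_mul, Complex.div_ofNat_re, zero_add]
        norm_num
      rw [hνe']
      simp only [Complex.add_re, Complex.conj_re, Complex.div_ofNat_re, Complex.natCast_re, hμ, hμ', Complex.one_re]
      linarith
    | weightZero =>
      refine rsGammaProduct_local_realShapeFn (by simp) (fun u hu => by rw [cbes _ _ u hu]) (rsGammaProduct_local_exp_bessel ?_)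
      have hb : |ν'.im| < 1 / 2 := ht'
      simp only [Complex.add_re, Complex.conj_re, Complex.conj_im, Complex.div_ofNat_re, Complex.natCast_re, hμ, hμ', abs_neg]
      linarith
    | weightZeroX =>
      refine rsGammaProduct_local_realShapeFn (by simp) (fun u hu => by rw [cbes _ _ u hu]) (rsGammaProduct_local_exp_bessel ?_)
      have hb : |ν'.im| ≤ 1 / 2 := ht'
      simp only [Complex.add_re, Complex.conj_re, Complex.conj_im, Complex.div_ofNat_re, Complex.natCast_re, hμ, hμ', abs_neg,
        Complex.one_re]
      linarith
  | weightOneSym κ =>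
    have hκ : κ.re = 0 := ht
    have hνe : |(Complex.I * (κ - 1 / 2)).im| = 1 / 2 := by
      simp only [Complex.mul_im, Complex.I_re, Complex.I_im, Complex.sub_re, Complex.one_re, hκ, zero_mul, one_mul,
        Complex.div_ofNat_re, zero_add]
      norm_num
    cases t' with
    | discPlus k' =>
      have hk' : (1 : ℝ) ≤ k' := by exact_mod_cast ht'
      refine rsGammaProduct_local_realShapeFn (by simp) (fun u hu => by rw [cexp _ u hu]) (rsGammaProduct_local_bessel_exp ?_)
      rw [hνe]
      simp only [Complex.add_re, Complex.conj_re, Complex.div_ofNat_re, Complex.natCast_re, hμ, hμ', Complex.one_re]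
      linarith
    | weightOneSym κ' =>
      have hκ' : κ'.re = 0 := ht'
      have hνe' : |(conj (Complex.I * (κ' - 1 / 2))).im| = 1 / 2 := by
        simp only [Complex.conj_im, abs_neg, Complex.mul_im, Complex.I_re, Complex.I_im, Complex.sub_re, Complex.one_re, hκ',
          zero_mul, one_mul, Complex.div_ofNat_re, zero_add]
        norm_num
      refine rsGammaProduct_local_realShapeFn (by norm_num) (fun u hu => by rw [cbes _ _ u hu]) (rsGammaProduct_local_bessel_bessel ?_)
      rw [hνe, hνe']
      simp only [Complex.add_re, Complex.conj_re, Complex.div_ofNat_re, hμ, hμ', Complex.one_re]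
      norm_num
    | weightZero =>
      have hb : |ν'.im| < 1 / 2 := ht'
      refine rsGammaProduct_local_realShapeFn (by norm_num) (fun u hu => by rw [cbes _ _ u hu]) (rsGammaProduct_local_bessel_bessel ?_)
      rw [hνe, Complex.conj_im, abs_neg]
      simp only [Complex.add_re, Complex.conj_re, Complex.div_ofNat_re, hμ, hμ', Complex.one_re]
      linarith
    | weightZeroX =>
      have hb : |ν'.im| ≤ 1 / 2 := ht'
      refine rsGammaProduct_local_realShapeFn (by norm_num) (fun u hu => by rw [cbes _ _ u hu]) (rsGammaProduct_local_bessel_bessel ?_)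
      rw [hνe, Complex.conj_im, abs_neg]
      simp only [Complex.add_re, Complex.conj_re, Complex.div_ofNat_re, hμ, hμ', Complex.one_re]
      linarith
  | weightZero =>
    have hb0 : |ν.im| < 1 / 2 := ht
    cases t' with
    | discPlus k' =>
      have hk' : (1 : ℝ) ≤ k' := by exact_mod_cast ht'
      refine rsGammaProduct_local_realShapeFn (by simp) (fun u hu => by rw [cexp _ u hu]) (rsGammaProduct_local_bessel_exp ?_)
      simp only [Complex.add_re, Complex.conj_re, Complex.div_ofNat_re, Complex.natCast_re, hμ, hμ']
      linarith
    | weightOneSym κ' =>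
      have hκ' : κ'.re = 0 := ht'
      have hνe' : |(conj (Complex.I * (κ' - 1 / 2))).im| = 1 / 2 := by
        simp only [Complex.conj_im, abs_neg, Complex.mul_im, Complex.I_re, Complex.I_im, Complex.sub_re, Complex.one_re, hκ',
          zero_mul, one_mul, Complex.div_ofNat_re, zero_add]
        norm_num
      refine rsGammaProduct_local_realShapeFn (by norm_num) (fun u hu => by rw [cbes _ _ u hu]) (rsGammaProduct_local_bessel_bessel ?_)
      rw [hνe']
      simp only [Complex.add_re, Complex.conj_re, Complex.div_ofNat_re, hμ, hμ', Complex.one_re]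
      linarith
    | weightZero =>
      have hb : |ν'.im| < 1 / 2 := ht'
      refine rsGammaProduct_local_realShapeFn (by norm_num) (fun u hu => by rw [cbes _ _ u hu]) (rsGammaProduct_local_bessel_bessel ?_)
      rw [Complex.conj_im, abs_neg]
      simp only [Complex.add_re, Complex.conj_re, Complex.div_ofNat_re, hμ, hμ']
      linarith
    | weightZeroX =>
      have hb : |ν'.im| ≤ 1 / 2 := ht'
      refine rsGammaProduct_local_realShapeFn (by norm_num) (fun u hu => by rw [cbes _ _ u hu]) (rsGammaProduct_local_bessel_bessel ?_)
      rw [Complex.conj_im, abs_neg]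
      simp only [Complex.add_re, Complex.conj_re, Complex.div_ofNat_re, hμ, hμ', Complex.one_re]
      linarith
  | weightZeroX =>
    have hb0 : |ν.im| ≤ 1 / 2 := ht
    cases t' with
    | discPlus k' =>
      have hk' : (1 : ℝ) ≤ k' := by exact_mod_cast ht'
      refine rsGammaProduct_local_realShapeFn (by simp) (fun u hu => by rw [cexp _ u hu]) (rsGammaProduct_local_bessel_exp ?_)
      simp only [Complex.add_re, Complex.conj_re, Complex.div_ofNat_re, Complex.natCast_re, hμ, hμ', Complex.one_re]
      linarith
    | weightOneSym κ' =>
      have hκ' : κ'.re = 0 := ht'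
      have hνe' : |(conj (Complex.I * (κ' - 1 / 2))).im| = 1 / 2 := by
        simp only [Complex.conj_im, abs_neg, Complex.mul_im, Complex.I_re, Complex.I_im, Complex.sub_re, Complex.one_re, hκ',
          zero_mul, one_mul, Complex.div_ofNat_re, zero_add]
        norm_num
      refine rsGammaProduct_local_realShapeFn (by norm_num) (fun u hu => by rw [cbes _ _ u hu]) (rsGammaProduct_local_bessel_bessel ?_)
      rw [hνe']
      simp only [Complex.add_re, Complex.conj_re, Complex.div_ofNat_re, hμ, hμ', Complex.one_re]
      linarith
    | weightZero =>
      have hb : |ν'.im| < 1 / 2 := ht'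
      refine rsGammaProduct_local_realShapeFn (by norm_num) (fun u hu => by rw [cbes _ _ u hu]) (rsGammaProduct_local_bessel_bessel ?_)
      rw [Complex.conj_im, abs_neg]
      simp only [Complex.add_re, Complex.conj_re, Complex.div_ofNat_re, hμ, hμ', Complex.one_re]
      linarith
    | weightZeroX =>
      have hb : |ν'.im| ≤ 1 / 2 := ht'
      refine rsGammaProduct_local_realShapeFn (by norm_num) (fun u hu => by rw [cbes _ _ u hu]) (rsGammaProduct_local_bessel_bessel ?_)
      rw [Complex.conj_im, abs_neg]
      simp only [Complex.add_re, Complex.conj_re, Complex.div_ofNat_re, hμ, hμ', Complex.one_re]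
      linarith

/-- **The local Gamma identity at a COMPLEX place, refined hypotheses, recursor form.** As
`rsGammaProduct_local_complexTag` (`ArchRankinSelbergGammaLocalGL2`) with the blanket bounds weakened to the
NON-STRICT `|im ν^a|, |im ν^h| ≤ m/2 + 1` of `sq_im_besselParamC_le` (any non-zero highest-weight vector) and the
strict inequality required only where there is no slack: `holPow b` (`τ^h(E₀₁) y ≠ 0` or `y` itself `K_∞`-finite),
`antiPowLowest 0` (the lowest vector is a `K_∞`-translate of `y`), strings carrying `im ν^a = m/2` — the form in
which the assembly obtains them from `ArchUnitarityBoundsGL2Complex`; exponents as `ComplexTag.rec` terms.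
[cite: Jacquet1972GL2II, §17–§19] [cite: HumphriesJo2024, Thm. 5.6 and Prop. 5.8] -/
theorem rsGammaProduct_local_complexTagRec₂ (μ₁ : ℂ) (m : ℕ) (νa νh : ℂ) (t : ComplexTag) (μ₁' : ℂ) (m' : ℕ) (νa' νh' : ℂ)
    (t' : ComplexTag) (hμ : μ₁.re = 0) (hμ' : μ₁'.re = 0)
    (hνa : |νa.im| ≤ (m : ℝ) / 2 + 1) (hνh : |νh.im| ≤ (m : ℝ) / 2 + 1)
    (hνa' : |νa'.im| ≤ (m' : ℝ) / 2 + 1) (hνh' : |νh'.im| ≤ (m' : ℝ) / 2 + 1)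
    (ht : match t with
      | .holPow _ => |νa.im| < (m : ℝ) / 2 + 1
      | .antiPowLowest b => b = 0 → |νh.im| < (m : ℝ) / 2 + 1
      | .string j => νa.im = (m : ℝ) / 2 ∧ j ≤ m)
    (ht' : match t' with
      | .holPow _ => |νa'.im| < (m' : ℝ) / 2 + 1
      | .antiPowLowest b => b = 0 → |νh'.im| < (m' : ℝ) / 2 + 1
      | .string j => νa'.im = (m' : ℝ) / 2 ∧ j ≤ m') :
    (∀ s : ℂ, 1 < s.re → Integrable (fun x : ℂ =>
      complexShapeOf μ₁ m νa νh t x * conj (complexShapeOf μ₁' m' νa' νh' t' x) * ((‖x‖ ^ 2 : ℝ) : ℂ) ^ (s - 2))) ∧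
    ∃ (A : ℂ) (c : ℝ) (d₁ d₂ : ℕ) (a : Fin d₁ → ℂ) (b : Fin d₂ → ℂ), A ≠ 0 ∧ 0 < c ∧ (∀ j, -1 < (a j).re) ∧
      (∀ j, -1 < (b j).re) ∧ ∀ s : ℂ, 1 < s.re →
        ((Real.pi / 2 : ℂ) * (2 : ℂ) ^ (2 * s + (2 * (ComplexTag.rec (motive := fun _ => ℂ) (fun b => (μ₁ + m + 1) / 2 + b)
            (fun b => (μ₁ + m + 1) / 2 + b) (fun _ => (μ₁ + m + 1) / 2) t +
            conj (ComplexTag.rec (motive := fun _ => ℂ) (fun b => (μ₁' + m' + 1) / 2 + b)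
            (fun b => (μ₁' + m' + 1) / 2 + b) (fun _ => (μ₁' + m' + 1) / 2) t')) - 2) / 2) *
          Complex.Gammaℂ (2 * s + (2 * (ComplexTag.rec (motive := fun _ => ℂ) (fun b => (μ₁ + m + 1) / 2 + b)
            (fun b => (μ₁ + m + 1) / 2 + b) (fun _ => (μ₁ + m + 1) / 2) t +
            conj (ComplexTag.rec (motive := fun _ => ℂ) (fun b => (μ₁' + m' + 1) / 2 + b)
            (fun b => (μ₁' + m' + 1) / 2 + b) (fun _ => (μ₁' + m' + 1) / 2) t')) - 2) / 2)) *
          ∫ x : ℂ, complexShapeOf μ₁ m νa νh t x * conj (complexShapeOf μ₁' m' νa' νh' t' x) * ((‖x‖ ^ 2 : ℝ) : ℂ) ^ (s - 2) =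
          A * (c : ℂ) ^ s * ((∏ j, Complex.Gammaℝ (s + a j)) * ∏ j, Complex.Gammaℂ (s + b j)) := by
  have hm0 : (0 : ℝ) ≤ m := Nat.cast_nonneg m
  have hm0' : (0 : ℝ) ≤ m' := Nat.cast_nonneg m'
  -- per side: `|im ν(t)| < re β(t) + ½`
  have side : ∀ (μ₀ : ℂ) (m₀ : ℕ) (νa₀ νh₀ : ℂ) (t₀ : ComplexTag), μ₀.re = 0 → |νa₀.im| ≤ (m₀ : ℝ) / 2 + 1 → |νh₀.im| ≤ (m₀ : ℝ) / 2 + 1 →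
      (match t₀ with
        | .holPow _ => |νa₀.im| < (m₀ : ℝ) / 2 + 1
        | .antiPowLowest b => b = 0 → |νh₀.im| < (m₀ : ℝ) / 2 + 1
        | .string j => νa₀.im = (m₀ : ℝ) / 2 ∧ j ≤ m₀) →
      |(ComplexTag.rec (motive := fun _ => ℂ) (fun _ => νa₀) (fun _ => νh₀) (fun j => νa₀ - Complex.I * j) t₀).im| <
        (ComplexTag.rec (motive := fun _ => ℂ) (fun b => (μ₀ + m₀ + 1) / 2 + b) (fun b => (μ₀ + m₀ + 1) / 2 + b)
          (fun _ => (μ₀ + m₀ + 1) / 2) t₀).re + 1 / 2 := by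
    intro μ₀ m₀ νa₀ νh₀ t₀ hμ₀ ha hh ht₀
    cases t₀ with
    | holPow b =>
      have hb : (0 : ℝ) ≤ b := Nat.cast_nonneg b
      have hstrict : |νa₀.im| < (m₀ : ℝ) / 2 + 1 := ht₀
      simp only [Complex.add_re, Complex.div_ofNat_re, Complex.natCast_re, Complex.one_re, hμ₀]
      linarith
    | antiPowLowest b =>
      simp only [Complex.add_re, Complex.div_ofNat_re, Complex.natCast_re, Complex.one_re, hμ₀]
      rcases Nat.eq_zero_or_pos b with hb0 | hbpos
      · have hstrict : |νh₀.im| < (m₀ : ℝ) / 2 + 1 := ht₀ hb0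
        have hb : (0 : ℝ) ≤ b := Nat.cast_nonneg b
        linarith
      · have hb1 : (1 : ℝ) ≤ b := by exact_mod_cast hbpos
        linarith
    | string j =>
      obtain ⟨hstr, hj⟩ := ht₀
      have hj' : (j : ℝ) ≤ m₀ := by exact_mod_cast hj
      have hj0 : (0 : ℝ) ≤ j := Nat.cast_nonneg j
      simp only [Complex.sub_im, Complex.mul_im, Complex.I_re, Complex.I_im, Complex.natCast_re, Complex.natCast_im, zero_mul,
        one_mul, hstr, Complex.add_re, Complex.div_ofNat_re, Complex.one_re, hμ₀]
      rw [abs_lt]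
      constructor <;> linarith
  have hs := side μ₁ m νa νh t hμ hνa hνh ht
  have hs' := side μ₁' m' νa' νh' t' hμ' hνa' hνh' ht'
  -- the bound `|im ν(t)| + |im ν(t')| < re(β(t) + conj β(t')) + 1`
  have key : ∀ {ν₀ ν₀' β₀ β₀' : ℂ}, |ν₀.im| < β₀.re + 1 / 2 → |ν₀'.im| < β₀'.re + 1 / 2 →
      |ν₀.im| + |ν₀'.im| < (β₀ + conj β₀').re + 1 := fun h1 h2 => by
    rw [Complex.add_re, Complex.conj_re]; linarith
  cases t with
  | holPow b =>
    cases t' with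
    | holPow b' => exact rsGammaProduct_local_complex_conj (key hs hs')
    | antiPowLowest b' => exact rsGammaProduct_local_complex_conj (key hs hs')
    | string j' => exact rsGammaProduct_local_complex_conj (key hs hs')
  | antiPowLowest b =>
    cases t' with
    | holPow b' => exact rsGammaProduct_local_complex_conj (key hs hs')
    | antiPowLowest b' => exact rsGammaProduct_local_complex_conj (key hs hs')
    | string j' => exact rsGammaProduct_local_complex_conj (key hs hs')
  | string j =>
    cases t' with
    | holPow b' => exact rsGammaProduct_local_complex_conj (key hs hs')
    | antiPowLowest b' => exact rsGammaProduct_local_complex_conj (key hs hs')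
    | string j' => exact rsGammaProduct_local_complex_conj (key hs hs')



end Local

/-! ### 2. The global identity with refined hypotheses -/

section Global

variable (K : Type) [Field K] [NumberField K]

/-- `re β(t) ≥ 0` for a real tag with the refined constraints and `re μ = 0`. [folklore] -/
theorem re_realTagExponentRec_nonneg₂ (μ ν : ℂ) (t : RealTag) (hμ : μ.re = 0)
    (ht : match t with
      | .discPlus k => 1 ≤ k
      | .weightOneSym κ => κ.re = 0
      | .weightZero => |ν.im| < 1 / 2
      | .weightZeroX => |ν.im| ≤ 1 / 2) :
    0 ≤ (RealTag.rec (motive := fun _ => ℂ) (fun k => (μ + k) / 2) (fun _ => (μ + 1) / 2) (μ / 2) (μ / 2 + 1) t).re := by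
  cases t with
  | discPlus k =>
    have hk : (0 : ℝ) ≤ k := Nat.cast_nonneg k
    simp only [Complex.div_ofNat_re, Complex.add_re, Complex.natCast_re, hμ]
    linarith
  | weightOneSym κ =>
    simp only [Complex.div_ofNat_re, Complex.add_re, Complex.one_re, hμ]
    norm_num
  | weightZero =>
    simp only [Complex.div_ofNat_re, hμ]
    norm_num
  | weightZeroX =>
    simp only [Complex.div_ofNat_re, Complex.add_re, Complex.one_re, hμ]
    norm_num

set_option maxHeartbeats 1600000 in
/-- **The Gamma bookkeeping of the archimedean `GL₂ × GL₂` Rankin–Selberg integral for a pair of tagged test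
vectors, refined hypotheses** (`weightZeroX`: `|im ν| ≤ ½`; complex: blanket `≤ m/2+1`, strict only on `holPow`,
`antiPowLowest 0`, strings `im ν^a = m/2`; otherwise verbatim `rsGammaProduct_archRankinSelberg_tagged`).** Data: at every real place `w` the central scalars `μ_w, μ'_w` (purely imaginary), Bessel parameters
`ν_w, ν'_w` and tags `t_w, t'_w` of the two vectors with the unitarity bounds (`ArchUnitarityBoundsGL2Real`), at
every complex place the central scalars `μ₁`, minimal types `m`, Bessel parameters `ν^a, ν^h` and tags with the
unitarity bounds (`ArchUnitarityBoundsGL2Complex`); the product `H(u) = C ∏_w S_{t_w}(u_w) conj S'_{t'_w}(u_w) ·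
∏_w S_{t_w}(u_w) conj S'_{t'_w}(u_w)` (`C ≠ 0`) of the two factorised Kirillov functions
(`ArchKirillovFactorisationGL2`, `realShapeOf`, `complexShapeOf`); and a Tate integrand `g` which is the radial
Gaussian monomial of exponents `p_w = 2(β(t_w) + conj β(t'_w))` (real) and `q_w = 2(β(t_w) + conj β(t'_w)) - 2`
(complex) — the degree of the weight polynomial (`p + p'`, resp. `n + n'`) plus the central exponents. Then for
any Haar measures `μ_c` on `K_∞ˣ` and `μ_A'` on `K_∞ˣ = (Fin 1 → K_∞ˣ)`:
`(∫ g N^{2s} dμ_c) · ∫ H(y' 0) N(y' 0)^{s-1} dμ_A'(y') = A c^s ∏_j Γ_ℝ(s + a_j) ∏_j Γ_ℂ(s + b_j)` on `re s > 1`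
with `A ≠ 0`, `c > 0`, `re a_j, re b_j > -1` (Tate's factor `ArchRankinSelbergTateFactorGL2`, Fubini over
`K_∞ˣ` `integrable_and_integral_units_prod_mul_norm_cpow`, and the local bookkeeping
`rsGammaProduct_local_realTag` / `rsGammaProduct_local_complexTag`). This is the analytic half
(Humphries–Jo (2024), Thm. 5.6 with Prop. 5.8: `Ψ = L(s, π_ur × σ_ur)`, a Gamma product) of the `K_∞`-average
Gamma identity of `HumphriesJo2024_archRankinSelberg_testVector_two_gammaIdentity_of_kAverage`.
[cite: HumphriesJo2024, Thm. 5.6, Prop. 5.8] [cite: Jacquet1972GL2II, §17–§19] -/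
theorem rsGammaProduct_archRankinSelberg_tagged₂ [mU : MeasurableSpace ((mixedSpace K)ˣ)] [hmU : BorelSpace ((mixedSpace K)ˣ)]
    (μc : Measure (mixedSpace K)ˣ) [IsHaarMeasure μc]
    (μA' : Measure (Fin 1 → (mixedSpace K)ˣ)) [IsHaarMeasure μA']
    (μR νR : {w : InfinitePlace K // IsReal w} → ℂ) (tR : {w : InfinitePlace K // IsReal w} → RealTag)
    (μR' νR' : {w : InfinitePlace K // IsReal w} → ℂ) (tR' : {w : InfinitePlace K // IsReal w} → RealTag)
    (hμR : ∀ w, (μR w).re = 0) (hμR' : ∀ w, (μR' w).re = 0)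
    (htR : ∀ w, match tR w with
      | .discPlus k => 1 ≤ k
      | .weightOneSym κ => κ.re = 0
      | .weightZero => |(νR w).im| < 1 / 2
      | .weightZeroX => |(νR w).im| ≤ 1 / 2)
    (htR' : ∀ w, match tR' w with
      | .discPlus k => 1 ≤ k
      | .weightOneSym κ => κ.re = 0
      | .weightZero => |(νR' w).im| < 1 / 2
      | .weightZeroX => |(νR' w).im| ≤ 1 / 2)
    (μC : {w : InfinitePlace K // IsComplex w} → ℂ) (mC : {w : InfinitePlace K // IsComplex w} → ℕ)
    (νa νh : {w : InfinitePlace K // IsComplex w} → ℂ) (tC : {w : InfinitePlace K // IsComplex w} → ComplexTag)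
    (μC' : {w : InfinitePlace K // IsComplex w} → ℂ) (mC' : {w : InfinitePlace K // IsComplex w} → ℕ)
    (νa' νh' : {w : InfinitePlace K // IsComplex w} → ℂ) (tC' : {w : InfinitePlace K // IsComplex w} → ComplexTag)
    (hμC : ∀ w, (μC w).re = 0) (hμC' : ∀ w, (μC' w).re = 0)
    (hνa : ∀ w, |(νa w).im| ≤ (mC w : ℝ) / 2 + 1) (hνh : ∀ w, |(νh w).im| ≤ (mC w : ℝ) / 2 + 1)
    (hνa' : ∀ w, |(νa' w).im| ≤ (mC' w : ℝ) / 2 + 1) (hνh' : ∀ w, |(νh' w).im| ≤ (mC' w : ℝ) / 2 + 1)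
    (htC : ∀ w, match tC w with
      | .holPow _ => |(νa w).im| < (mC w : ℝ) / 2 + 1
      | .antiPowLowest b => b = 0 → |(νh w).im| < (mC w : ℝ) / 2 + 1
      | .string j => (νa w).im = (mC w : ℝ) / 2 ∧ j ≤ mC w)
    (htC' : ∀ w, match tC' w with
      | .holPow _ => |(νa' w).im| < (mC' w : ℝ) / 2 + 1
      | .antiPowLowest b => b = 0 → |(νh' w).im| < (mC' w : ℝ) / 2 + 1
      | .string j => (νa' w).im = (mC' w : ℝ) / 2 ∧ j ≤ mC' w)
    (p : {w : InfinitePlace K // IsReal w} → ℂ)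
    (hp : ∀ w, p w = 2 * (RealTag.rec (motive := fun _ => ℂ) (fun k => (μR w + k) / 2) (fun _ => (μR w + 1) / 2) (μR w / 2) (μR w / 2 + 1) (tR w) +
      conj (RealTag.rec (motive := fun _ => ℂ) (fun k => (μR' w + k) / 2) (fun _ => (μR' w + 1) / 2) (μR' w / 2) (μR' w / 2 + 1) (tR' w))))
    (q : {w : InfinitePlace K // IsComplex w} → ℂ)
    (hq : ∀ w, q w = 2 * (ComplexTag.rec (motive := fun _ => ℂ) (fun b => (μC w + mC w + 1) / 2 + b)
        (fun b => (μC w + mC w + 1) / 2 + b) (fun _ => (μC w + mC w + 1) / 2) (tC w) +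
      conj (ComplexTag.rec (motive := fun _ => ℂ) (fun b => (μC' w + mC' w + 1) / 2 + b)
        (fun b => (μC' w + mC' w + 1) / 2 + b) (fun _ => (μC' w + mC' w + 1) / 2) (tC' w))) - 2)
    (g : (mixedSpace K)ˣ → ℂ)
    (hg : ∀ c : (mixedSpace K)ˣ, g c =
      (∏ w, (((|((c : (mixedSpace K)ˣ) : mixedSpace K).1 w| : ℝ) : ℂ)) ^ (p w) *
        (Real.exp (-(Real.pi * (((c : (mixedSpace K)ˣ) : mixedSpace K).1 w) ^ 2)) : ℂ)) *
      ∏ w, (((‖((c : (mixedSpace K)ˣ) : mixedSpace K).2 w‖ : ℝ) : ℂ) ^ (q w) *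
        (Real.exp (-(Real.pi * ‖((c : (mixedSpace K)ˣ) : mixedSpace K).2 w‖ ^ 2)) : ℂ)))
    (C : ℂ) (hC : C ≠ 0) (H : (mixedSpace K)ˣ → ℂ)
    (hH : ∀ u : (mixedSpace K)ˣ, H u = C * ((∏ w, realShapeOf (μR w) (νR w) (tR w) (((u : (mixedSpace K)ˣ) : mixedSpace K).1 w) *
        conj (realShapeOf (μR' w) (νR' w) (tR' w) (((u : (mixedSpace K)ˣ) : mixedSpace K).1 w))) *
      ∏ w, complexShapeOf (μC w) (mC w) (νa w) (νh w) (tC w) (((u : (mixedSpace K)ˣ) : mixedSpace K).2 w) *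
        conj (complexShapeOf (μC' w) (mC' w) (νa' w) (νh' w) (tC' w) (((u : (mixedSpace K)ˣ) : mixedSpace K).2 w)))) :
    ∃ (A : ℂ) (c : ℝ) (d₁ d₂ : ℕ) (a : Fin d₁ → ℂ) (b : Fin d₂ → ℂ), A ≠ 0 ∧ 0 < c ∧ (∀ j, -1 < (a j).re) ∧
      (∀ j, -1 < (b j).re) ∧ ∀ s : ℂ, 1 < s.re →
        (∫ cc, g cc * ((mixedEmbedding.norm ((cc : (mixedSpace K)ˣ) : mixedSpace K) : ℝ) : ℂ) ^ (2 * s) ∂μc) *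
          ∫ y' : Fin 1 → (mixedSpace K)ˣ, H (y' 0) *
            ((mixedEmbedding.norm ((y' 0 : (mixedSpace K)ˣ) : mixedSpace K) : ℝ) : ℂ) ^ (s - 1) ∂μA' =
          A * (c : ℂ) ^ s * ((∏ j, Complex.Gammaℝ (s + a j)) * ∏ j, Complex.Gammaℂ (s + b j)) := by
  -- Mathlib's (Borel) measurable structure on `K_∞ˣ`
  have hmU' : mU = Units.instMeasurableSpace := by
    rw [hmU.measurable_eq]
    exact (Literature.MeasureTheory.Group.Units.borelSpace_of_isOpenEmbedding (A := mixedSpace K)).measurable_eq.symm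
  subst hmU'
  -- Tate's factor
  obtain ⟨cμ, hcμ, hT⟩ := tateFactor_units_eq K μc
  -- transport `μ_A'` to `K_∞ˣ`
  set eU : (Fin 1 → (mixedSpace K)ˣ) ≃ᵐ (mixedSpace K)ˣ := MeasurableEquiv.funUnique (Fin 1) (mixedSpace K)ˣ with heU
  haveI hHaar : IsHaarMeasure (μA'.map eU) := by
    have hco : (⇑eU : (Fin 1 → (mixedSpace K)ˣ) → (mixedSpace K)ˣ) = ⇑(MulEquiv.funUnique (Fin 1) (mixedSpace K)ˣ) := rfl
    rw [hco]
    exact MulEquiv.isHaarMeasure_map μA' _ (continuous_apply _) (continuous_pi fun _ => continuous_id)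
  obtain ⟨cA, hcA, hM⟩ := integrable_and_integral_units_prod_mul_norm_cpow K (μA'.map eU)
  -- the one-variable factors
  set F : {w : InfinitePlace K // IsReal w} → ℝ → ℂ := fun w t =>
    realShapeOf (μR w) (νR w) (tR w) t * conj (realShapeOf (μR' w) (νR' w) (tR' w) t) with hFdef
  set G : {w : InfinitePlace K // IsComplex w} → ℂ → ℂ := fun w z =>
    complexShapeOf (μC w) (mC w) (νa w) (νh w) (tC w) z * conj (complexShapeOf (μC' w) (mC' w) (νa' w) (νh' w) (tC' w) z) with hGdef
  have hFm : ∀ w, Measurable (F w) := fun w =>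
    (measurable_realShapeOf _ _ _).mul (Complex.continuous_conj.measurable.comp (measurable_realShapeOf _ _ _))
  have hGm : ∀ w, Measurable (G w) := fun w =>
    (measurable_complexShapeOf _ _ _ _ _).mul (Complex.continuous_conj.measurable.comp (measurable_complexShapeOf _ _ _ _ _))
  -- the local bookkeeping
  have hR := fun w => rsGammaProduct_local_realTagRec₂ (μR w) (νR w) (tR w) (μR' w) (νR' w) (tR' w) (hμR w) (hμR' w) (htR w) (htR' w)
  have hX := fun w => rsGammaProduct_local_complexTagRec₂ (μC w) (mC w) (νa w) (νh w) (tC w) (μC' w) (mC' w) (νa' w) (νh' w) (tC' w)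
    (hμC w) (hμC' w) (hνa w) (hνh w) (hνa' w) (hνh' w) (htC w) (htC' w)
  -- the Gamma product
  have hconst : ((cμ : ℂ) * cA * C) ≠ 0 :=
    mul_ne_zero (mul_ne_zero (Complex.ofReal_ne_zero.mpr hcμ.ne') (Complex.ofReal_ne_zero.mpr hcA.ne')) hC
  refine rsGammaProduct_congr (rsGammaProduct_mul (rsGammaProduct_mul (rsGammaProduct_const hconst)
    (rsGammaProduct_finset_prod Finset.univ fun w _ => (hR w).2))
    (rsGammaProduct_finset_prod Finset.univ fun w _ => (hX w).2)) fun s hs => ?_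
  -- ### the identity at `s`
  -- Tate's factor
  have hp0 : ∀ w, 0 < (2 * s + p w).re := fun w => by
    have h := re_realTagExponentRec_nonneg₂ (μR w) (νR w) (tR w) (hμR w) (htR w)
    have h' := re_realTagExponentRec_nonneg₂ (μR' w) (νR' w) (tR' w) (hμR' w) (htR' w)
    rw [hp w]
    simp only [Complex.add_re, Complex.mul_re, Complex.re_ofNat, Complex.im_ofNat, zero_mul, sub_zero, Complex.conj_re] at h h' ⊢
    nlinarith
  have hq0 : ∀ w, 0 < (2 * s + q w / 2).re := fun w => by
    have h := re_complexTagExponentRec_ge (μC w) (mC w) (tC w) (hμC w)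
    have h' := re_complexTagExponentRec_ge (μC' w) (mC' w) (tC' w) (hμC' w)
    rw [hq w]
    simp only [Complex.add_re, Complex.sub_re, Complex.mul_re, Complex.re_ofNat, Complex.im_ofNat, zero_mul, sub_zero,
      Complex.conj_re, Complex.div_ofNat_re] at h h' ⊢
    nlinarith
  rw [hT p q g s hp0 hq0 hg]
  -- the Mellin transform: to `K_∞ˣ`
  have hM1 : ∫ y' : Fin 1 → (mixedSpace K)ˣ, H (y' 0) *
      ((mixedEmbedding.norm ((y' 0 : (mixedSpace K)ˣ) : mixedSpace K) : ℝ) : ℂ) ^ (s - 1) ∂μA' =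
      ∫ u : (mixedSpace K)ˣ, H u * ((mixedEmbedding.norm ((u : (mixedSpace K)ˣ) : mixedSpace K) : ℝ) : ℂ) ^ (s - 1) ∂(μA'.map eU) := by
    rw [integral_map_equiv eU]
    rfl
  rw [hM1]
  -- Fubini over the places
  have e1 : (s - 1 / 2 - 3 / 2 : ℂ) = s - 2 := by ring
  have e2 : (s - 1 / 2 - 1 / 2 : ℂ) = s - 1 := by ring
  have hFi : ∀ w, Integrable fun t : ℝ => F w t * ((|t| : ℝ) : ℂ) ^ (s - 1 / 2 - 3 / 2) := fun w => by
    rw [e1]; exact (hR w).1 s hs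
  have hGi : ∀ w, Integrable fun z : ℂ => G w z * ((‖z‖ ^ 2 : ℝ) : ℂ) ^ (s - 1 / 2 - 3 / 2) := fun w => by
    rw [e1]; exact (hX w).1 s hs
  obtain ⟨-, hval⟩ := hM F G (s - 1 / 2) hFm hGm hFi hGi
  rw [e1, e2] at hval
  have hM2 : ∫ u : (mixedSpace K)ˣ, H u * ((mixedEmbedding.norm ((u : (mixedSpace K)ˣ) : mixedSpace K) : ℝ) : ℂ) ^ (s - 1) ∂(μA'.map eU) =
      C * (cA * ((∏ w, ∫ t : ℝ, F w t * ((|t| : ℝ) : ℂ) ^ (s - 2)) * ∏ w, ∫ z : ℂ, G w z * ((‖z‖ ^ 2 : ℝ) : ℂ) ^ (s - 2))) := by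
    rw [← hval, ← integral_const_mul]
    refine integral_congr_ae (Eventually.of_forall fun u => ?_)
    simp only []
    rw [hH u]
    ring
  rw [hM2]
  simp only [hp, hq, hFdef, hGdef, Finset.prod_mul_distrib]
  ring


end Global

end Literature.NumberTheory.Automorphic
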